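import Summits.SmoothPoincare4.SmoothPoincare4.Theorems.CongruenceShadowsAgkCor6SufficiencyFlowerCapDefs
import Summits.SmoothPoincare4.SmoothPoincare4.Theorems.CongruenceShadowsAgkCor6SufficiencyGeomMarkingDefs

/-!
# Stub `stub_capCell` of line `lp-by-sphere-system-surgery` for crux `AgkCor6Sufficiency`
(item stmt-SmoothPoincare4-10894, routes `CongruenceShadows` / `GroupTrisection`; lead reshape r6b,
capped melon)

**The cap cell of the flower surface.**  For `g ≥ 2` the map
`Ψ(w) = upperPt (flower g) (level g) (capA g w)` (`FlowerCap.capΨ`; `capA g w = ¼ · rot(e^{iπ/g}) w`)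
on the closed disc `B̄(0, 2) ⊂ ℝ²` is a chart-like `2`-cell of Juhász's flower surface
`Z_g = FlowerModel.flowerSurface g` (as a space, `F = univ`): it is the upper sheet over the planar
disc of radius `1/2`, where `flower ≤ prof < level` (`FlowerModel.prof_lt_level_of_le`), so the
sheet is a graph with positive height; its hole `Ψ(B(0,1))` is the trace of the open cap region
`capU = {‖proj p‖ < 1/4, p₂ > 0}`, its circle `Ψ(‖z‖ = 1)` the trace of `{‖proj p‖ = 1/4, p₂ > 0}`,
`Z_g ∩ O = Ψ(B(0,2))` for the open set `O = {‖proj p‖ < 1/2, p₂ > 0}`, and its base point is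
`Ψ(1, 0) = upperPt (pol ¼ (π/g)) = vArcFun hg ¼ = capPt hg 0` (the point where the `0`-th melon arc
crosses the cap circle).  Everything is an explicit computation with the tree's sheet API
(`PlanarDouble.upperPt_mem`, `eq_upperPt_of_mem`, `upperPt_injective`) and the planar rotations
(`FlowerModel.rot_rot_inv`, `rot_exp_pol`).  No `sorry`.
-/

set_option linter.dupNamespace false

noncomputable section

open Set Function Metric
open scoped Real unitInterval Manifold ContDiff Topology

namespace Summit.SmoothPoincare4.SmoothPoincare4.Cruxes.AgkCor6Sufficiency.LpBySphereSystemSurgery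

open Literature.Topology.FourManifolds Literature.Topology.FourManifolds.FlowerModel
open PlanarThickening PlanarDouble
open Literature.AlgebraicTopology.FundamentalGroup
open Literature.AlgebraicTopology.FundamentalGroup.VanKampen
open Literature.AlgebraicTopology.Homotopy

namespace FlowerCap

variable {g : ℕ}

/-! ## Helpers: the planar cell map -/

/-- The norm of the planar cell map: `‖capA w‖ = ‖w‖ / 4`. -/
private theorem norm_capA (w : EuclideanSpace ℝ (Fin 2)) : ‖capA g w‖ = capR * ‖w‖ := by
  rw [capA, norm_smul, FlowerModel.norm_rot, Real.norm_eq_abs, abs_of_pos capR_pos]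

/-- The planar cell map is `capR • (a linear isometry)`, hence injective. -/
private theorem capA_injective : Injective (capA g) := fun _ _ h =>
  (rot (Circle.exp (π / g))).injective (smul_right_injective _ capR_pos.ne' h)

/-- Every planar point `u` is `capA w` for the point `w = 4 · rot(e^{-iπ/g}) u`, of norm `4 ‖u‖`. -/
private theorem exists_capA_eq (u : EuclideanSpace ℝ (Fin 2)) :
    ∃ w, capA g w = u ∧ ‖w‖ = capR⁻¹ * ‖u‖ := by
  refine ⟨capR⁻¹ • rot (Circle.exp (π / g))⁻¹ u, ?_, ?_⟩
  · rw [capA, LinearIsometryEquiv.map_smul, rot_rot_inv, smul_smul, mul_inv_cancel₀ capR_pos.ne',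
      one_smul]
  · rw [norm_smul, FlowerModel.norm_rot, Real.norm_eq_abs, abs_of_pos (inv_pos.2 capR_pos)]

/-- Real scalars act on polar points through the radius. -/
private theorem smul_pol (c r θ : ℝ) : c • pol r θ = pol (c * r) θ := by
  apply toC.injective
  rw [LinearIsometryEquiv.map_smul, toC_pol, toC_pol, Complex.real_smul]
  push_cast
  ring

/-- The planar cell map sends the model base point `(1, 0) = pol 1 0` to `pol (1/4) (π/g)`. -/
private theorem capA_pol_one_zero : capA g (pol 1 0) = pol capR (π / g) := by
  rw [capA, rot_exp_pol, smul_pol, mul_one, zero_add]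

/-! ## Helpers: the cell map into `ℝ³` -/

/-- Near the origin the flower function is strictly below the level: `flower u < level` for
`‖u‖ ≤ 4/5` (`g ≥ 2`). -/
private theorem flower_lt_level_of_norm_le (hg : 2 ≤ g) {u : EuclideanSpace ℝ (Fin 2)}
    (hu : ‖u‖ ≤ 4 / 5) : flower g u < level g := by
  obtain ⟨θ, -, hθ⟩ := exists_eq_pol u
  rw [hθ]
  exact (flower_pol_le_prof (norm_nonneg u) θ).trans_lt
    (prof_lt_level_of_le hg (norm_nonneg u) hu)

/-- Over the disc `B̄(0, 2)` the planar cell map stays strictly inside the flower domain. -/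
private theorem flower_capA_lt_level (hg : 2 ≤ g) {w : EuclideanSpace ℝ (Fin 2)} (hw : ‖w‖ ≤ 2) :
    flower g (capA g w) < level g := by
  apply flower_lt_level_of_norm_le hg
  rw [norm_capA, capR_eq]
  linarith

/-- The cap cell map lands on the flower surface (over `B̄(0, 2)`). -/
private theorem capΨ_mem (hg : 2 ≤ g) {w : EuclideanSpace ℝ (Fin 2)} (hw : ‖w‖ ≤ 2) :
    capΨ g w ∈ flowerSurface g :=
  upperPt_mem (flower_capA_lt_level hg hw).le

/-- The cap cell map has positive height (over `B̄(0, 2)`). -/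
private theorem capΨ_apply_two_pos (hg : 2 ≤ g) {w : EuclideanSpace ℝ (Fin 2)} (hw : ‖w‖ ≤ 2) :
    0 < capΨ g w 2 := by
  rw [capΨ, upperPt_apply_two]
  exact Real.sqrt_pos.2 (sub_pos.2 (flower_capA_lt_level hg hw))

/-- The planar projection of the cap cell map is the planar cell map. -/
private theorem proj_capΨ (w : EuclideanSpace ℝ (Fin 2)) : proj (capΨ g w) = capA g w :=
  proj_upperPt _

/-- The cap cell map is continuous. -/
private theorem continuous_capΨ : Continuous (capΨ g) := by
  unfold capΨ capA
  exact (continuous_upperPt (contDiff_flower (g := g)).continuous).comp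
    ((rot (Circle.exp (π / g))).continuous.const_smul capR)

/-- The model base point of the disc is `pol 1 0`. -/
private theorem orthonormalBasisOneI_repr_one :
    (Complex.orthonormalBasisOneI.repr 1 : EuclideanSpace ℝ (Fin 2)) = pol 1 0 := by
  apply toC.injective
  rw [toC_pol]
  show Complex.orthonormalBasisOneI.repr.symm (Complex.orthonormalBasisOneI.repr 1) = _
  rw [LinearIsometryEquiv.symm_apply_apply]
  push_cast
  simp

/-- The cap cell map sends the model base point to the cap point of the `0`-th arc. -/
private theorem capΨ_pol_one_zero (hg : 2 ≤ g) : capΨ g (pol 1 0) = capPt hg 0 := by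
  rw [capΨ, capA_pol_one_zero, upperPt_pol_valley_eq_vArcFun hg, capPt, Rk]
  have h0 : ζC g 0 = 1 := by simp [ζC]
  rw [h0, inv_one, rot3_apply, rot_one, lift_proj_add]

/-! ## The cell -/

/-- **Images of the norm-defined parts of the disc under the cap cell**: if `Ψ : B̄(0, 2) → Z_g`
is `capΨ` pointwise, then for a property `P` of the radius implying `≤ 2`, a point `p` of the
flower surface lies in `Ψ({z | P ‖z‖})` iff `P (4 ‖proj p‖)` and `p₂ > 0`. -/
private theorem mem_image_capCell_iff (hg : 2 ≤ g)
    {Ψ : C(closedBall (0 : EuclideanSpace ℝ (Fin 2)) 2, ↥(flowerSurface g))}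
    (hΨ : ∀ w, (Ψ w : EuclideanSpace ℝ (Fin 3)) = capΨ g w) {P : ℝ → Prop}
    (hP : ∀ r, P r → r ≤ 2) (p : ↥(flowerSurface g)) :
    p ∈ Ψ '' {z | P ‖(z : EuclideanSpace ℝ (Fin 2))‖} ↔
      P (capR⁻¹ * ‖proj (p : EuclideanSpace ℝ (Fin 3))‖) ∧
        0 < (p : EuclideanSpace ℝ (Fin 3)) 2 := by
  constructor
  · rintro ⟨z, hz, rfl⟩
    have hz2 : ‖(z : EuclideanSpace ℝ (Fin 2))‖ ≤ 2 := mem_closedBall_zero_iff.1 z.2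
    rw [hΨ, proj_capΨ, norm_capA, ← mul_assoc, inv_mul_cancel₀ capR_pos.ne', one_mul]
    exact ⟨hz, capΨ_apply_two_pos hg hz2⟩
  · rintro ⟨hP', hpos⟩
    obtain ⟨w, hw, hnorm⟩ := exists_capA_eq (g := g) (proj (p : EuclideanSpace ℝ (Fin 3)))
    have hle : ‖w‖ ≤ 2 := hnorm ▸ hP _ hP'
    refine ⟨⟨w, mem_closedBall_zero_iff.2 hle⟩, ?_, ?_⟩
    · show P ‖w‖
      rw [hnorm]
      exact hP'
    · apply Subtype.ext
      rw [hΨ]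
      show upperPt (flower g) (level g) (capA g w) = p
      rw [hw]
      exact (eq_upperPt_of_mem p.2 hpos.le).symm

/-- **The cap cell** (registered stub `stub_capCell`): the upper sheet over `capA` is a chart-like
cell of the flower surface (as a space), its hole is the trace of the cap region `capU`, its circle
the trace of `{‖proj p‖ = 1/4, p₂ > 0}`, and its base point `Ψ (1, 0)` is the cap point of the
`0`-th arc. -/
theorem stub_capCell : ∀ (hg : 2 ≤ g), ∃ (Ψ : C(closedBall (0 : EuclideanSpace ℝ (Fin 2)) 2, ↥(flowerSurface g))) (O : Set ↥(flowerSurface g)), (∀ w, (Ψ w : EuclideanSpace ℝ (Fin 3)) = capΨ g w) ∧ IsChartCell univ Ψ O ∧ (∀ p : ↥(flowerSurface g), p ∈ cellHole Ψ ↔ (p : EuclideanSpace ℝ (Fin 3)) ∈ capU) ∧ (∀ p : ↥(flowerSurface g), p ∈ cellCircle Ψ ↔ (‖proj (p : EuclideanSpace ℝ (Fin 3))‖ = capR ∧ 0 < (p : EuclideanSpace ℝ (Fin 3)) 2)) ∧ (Ψ cellPt : EuclideanSpace ℝ (Fin 3)) = capPt hg 0 := by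
  intro hg
  -- the cell map `Ψ = capΨ` as a continuous map into the flower surface
  obtain ⟨Ψ, hΨ⟩ : ∃ Ψ : C(closedBall (0 : EuclideanSpace ℝ (Fin 2)) 2, ↥(flowerSurface g)),
      ∀ w, (Ψ w : EuclideanSpace ℝ (Fin 3)) = capΨ g w :=
    ⟨⟨fun w => ⟨capΨ g w, capΨ_mem hg (mem_closedBall_zero_iff.1 w.2)⟩,
      (continuous_capΨ.comp continuous_subtype_val).subtype_mk _⟩, fun _ => rfl⟩
  refine ⟨Ψ,
    {p | ‖proj (p : EuclideanSpace ℝ (Fin 3))‖ < capR * 2 ∧ 0 < (p : EuclideanSpace ℝ (Fin 3)) 2},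
    hΨ, ⟨?_, subset_univ _, ?_, ?_⟩, ?_, ?_, ?_⟩
  · -- injective
    intro z z' h
    have h' : capΨ g z = capΨ g z' := by rw [← hΨ, ← hΨ, h]
    exact Subtype.ext (capA_injective (upperPt_injective h'))
  · -- the set `O` is open
    have hc : Continuous fun p : ↥(flowerSurface g) => (p : EuclideanSpace ℝ (Fin 3)) :=
      continuous_subtype_val
    exact (isOpen_lt (continuous_norm.comp (proj.continuous.comp hc)) continuous_const).inter
      (isOpen_lt continuous_const ((EuclideanSpace.proj (2 : Fin 3)).continuous.comp hc))
  · -- `univ ∩ O = Ψ(B(0, 2))`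
    rw [univ_inter]
    ext p
    refine Iff.trans ?_
      (mem_image_capCell_iff hg hΨ (P := fun r : ℝ => r < 2) (fun r hr => hr.le) p).symm
    show ‖proj (p : EuclideanSpace ℝ (Fin 3))‖ < capR * 2 ∧ 0 < (p : EuclideanSpace ℝ (Fin 3)) 2 ↔
      capR⁻¹ * ‖proj (p : EuclideanSpace ℝ (Fin 3))‖ < 2 ∧ 0 < (p : EuclideanSpace ℝ (Fin 3)) 2
    rw [inv_mul_lt_iff₀ capR_pos]
  · -- the hole is the trace of `capU`
    intro p
    refine (mem_image_capCell_iff hg hΨ (P := fun r : ℝ => r < 1) (fun r hr => by linarith)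
      p).trans ?_
    show capR⁻¹ * ‖proj (p : EuclideanSpace ℝ (Fin 3))‖ < 1 ∧ 0 < (p : EuclideanSpace ℝ (Fin 3)) 2 ↔
      ‖proj (p : EuclideanSpace ℝ (Fin 3))‖ < capR ∧ 0 < (p : EuclideanSpace ℝ (Fin 3)) 2
    rw [inv_mul_lt_iff₀ capR_pos, mul_one]
  · -- the circle is the trace of `{‖proj p‖ = 1/4, p₂ > 0}`
    intro p
    refine (mem_image_capCell_iff hg hΨ (P := fun r : ℝ => r = 1) (fun r hr => by linarith)
      p).trans ?_
    show capR⁻¹ * ‖proj (p : EuclideanSpace ℝ (Fin 3))‖ = 1 ∧ 0 < (p : EuclideanSpace ℝ (Fin 3)) 2 ↔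
      ‖proj (p : EuclideanSpace ℝ (Fin 3))‖ = capR ∧ 0 < (p : EuclideanSpace ℝ (Fin 3)) 2
    rw [inv_mul_eq_one₀ capR_pos.ne', eq_comm]
  · -- the base point
    rw [hΨ]
    show capΨ g (Complex.orthonormalBasisOneI.repr 1) = capPt hg 0
    rw [orthonormalBasisOneI_repr_one, capΨ_pol_one_zero hg]

end FlowerCap

end Summit.SmoothPoincare4.SmoothPoincare4.Cruxes.AgkCor6Sufficiency.LpBySphereSystemSurgery

end
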